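import Literature.ModelTheory.ExponentialFields.CylindricalDecompositionProofs

/-!
# `BetaLinearSector` (stmt-KontsevichZagierPeriods-3897), line `fermat-sector-transport` —
# stub `stub_bandNewtonLeibniz_cad`

A `ℚ`-cylindrical decomposition of `ℝⁿ` whose bands are adapted to two `ℚ`-semialgebraic sets
`σ, τ ⊆ ℝⁿ⁺¹`: every band over every cell is contained in `τ` or disjoint from it, and over each
cell `S` a FIXED finite set `B` of band indices, with those bands contained in `σ`, catches every
`σ`-point over `S` that is not on one of the section graphs.

This is `IsSemialgebraic.exists_cylindricalDecomposition.exists_fibre_eq`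
(`Literature/ModelTheory/ExponentialFields/CylindricalDecomposition.lean`) re-run for the two-member
family `{σ, τ}` over the proved fact `IsSemialgebraic.exists_cylindricalDecomposition_holds`
(Basu–Pollack–Roy 2006, Cor. 5.7, `CylindricalDecompositionProofs.lean`): take the decomposition
`𝒯` of `ℝⁿ⁺¹` adapted to `{σ, τ}`; it is the stack of graphs and bands over a decomposition `𝒮` of
`ℝⁿ`; a band is a cell of the partition `𝒯`, hence inside `τ` (a union of cells) or disjoint from
it; a `σ`-point over `x ∈ S` lies in a cell of `σ`, which sits above the unique base cell `S ∋ x`.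
The statement is verbatim the registered engine sub-stub of the same name of crux `PlanarAreas`
(stmt-KontsevichZagierPeriods-4990).
-/

noncomputable section

namespace Summit.KontsevichZagierPeriods.FermatIsogeny.BetaLinearSector

open Set
open Literature.NumberTheory.Transcendental
open Literature.ModelTheory.ExponentialFields (IsSemialgebraic IsCylindricalDecomposition
  bandOver graphOver bandLower bandUpper snoc_mem_graphOver_iff snoc_mem_bandOver_iff)

/-- **Cylindrical decomposition with bands adapted to two semialgebraic sets.** For
`ℚ`-semialgebraic `σ, τ ⊆ ℝⁿ⁺¹` there are a `ℚ`-cylindrical decomposition `𝒮` of `ℝⁿ` and over each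
cell `S ∈ 𝒮` sections `ξ_{S,0} < ⋯ < ξ_{S,ℓ_S-1}`, `ℚ`-semialgebraic on `S`, such that every band
`bandOver S ξ_S j` is contained in `τ` or disjoint from `τ`, and for each `S` a FIXED set `B` of band
indices with `bandOver S ξ_S j ⊆ σ` (`j ∈ B`) such that every point `(x, t) ∈ σ` with `x ∈ S` lies on
a graph `t = ξ_{S,j} x` or in a band `ξ_{S,j-1} x < t < ξ_{S,j} x` with `j ∈ B`. Proof: the
decomposition of `ℝⁿ⁺¹` adapted to `{σ, τ}` (Cor. 5.7, proved in the tree) is the stack over a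
decomposition of `ℝⁿ`; bands are cells, `σ` and `τ` are unions of cells, cells are pairwise
disjoint, and the base cell below a point is unique. [cite: BasuPollackRoy2006, Cor. 5.7] -/
theorem stub_bandNewtonLeibniz_cad : ∀ {n : ℕ} {σ τ : Set (Fin (n + 1) → ℝ)}, IsSemialgebraic ℚ σ → IsSemialgebraic ℚ τ →
    ∃ (𝒮 : Finset (Set (Fin n → ℝ))) (l : Set (Fin n → ℝ) → ℕ) (ξ : (S : Set (Fin n → ℝ)) → Fin (l S) → (Fin n → ℝ) → ℝ),
      Literature.ModelTheory.ExponentialFields.IsCylindricalDecomposition ℚ n 𝒮 ∧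
      (∀ S ∈ 𝒮, ∀ j, IsSemialgebraicFunOn ℚ S (ξ S j)) ∧ (∀ S ∈ 𝒮, ∀ x ∈ S, StrictMono fun j => ξ S j x) ∧
      (∀ S ∈ 𝒮, ∀ j, Literature.ModelTheory.ExponentialFields.bandOver S (ξ S) j ⊆ τ ∨
        Disjoint (Literature.ModelTheory.ExponentialFields.bandOver S (ξ S) j) τ) ∧
      ∀ S ∈ 𝒮, ∃ B : Finset (Fin (l S + 1)), (∀ j ∈ B, Literature.ModelTheory.ExponentialFields.bandOver S (ξ S) j ⊆ σ) ∧
        ∀ x ∈ S, ∀ t : ℝ, (Fin.snoc x t : Fin (n + 1) → ℝ) ∈ σ → (∃ j, t = ξ S j x) ∨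
          ∃ j ∈ B, Literature.ModelTheory.ExponentialFields.bandLower (ξ S) j x < t ∧
            (t : EReal) < Literature.ModelTheory.ExponentialFields.bandUpper (ξ S) j x := by
  intro n σ τ hσ hτ
  classical
  obtain ⟨𝒯, h𝒯, had⟩ :=
    Literature.ModelTheory.ExponentialFields.IsSemialgebraic.exists_cylindricalDecomposition_holds
      (k := ℚ) ({σ, τ} : Finset (Set (Fin (n + 1) → ℝ)))
      (fun s hs => by
        rcases Finset.mem_insert.1 hs with rfl | hs
        · exact hσ
        · rw [Finset.mem_singleton] at hs
          subst hs
          exact hτ)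
  obtain ⟨𝒞σ, h𝒞σ, hσU⟩ := had σ (Finset.mem_insert_self σ _)
  obtain ⟨𝒞τ, h𝒞τ, hτU⟩ := had τ (Finset.mem_insert_of_mem (Finset.mem_singleton_self τ))
  obtain ⟨h𝒯part, -, 𝒮, h𝒮, l, ξ, -, hsa, hmono, hmem⟩ := h𝒯
  have h𝒮part := h𝒮.isPartition
  refine ⟨𝒮, l, ξ, h𝒮, hsa, hmono, fun S hS j => ?_, fun S hS => ?_⟩
  · -- (4): a band is a cell; `τ` is a union of cells; distinct cells are disjoint
    have hT : bandOver S (ξ S) j ∈ 𝒯 := (hmem _).2 ⟨S, hS, Or.inr ⟨j, rfl⟩⟩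
    by_cases hC : bandOver S (ξ S) j ∈ 𝒞τ
    · left
      rw [← hτU]
      exact subset_sUnion_of_mem hC
    · right
      rw [← hτU, disjoint_sUnion_right]
      intro T' hT'
      have hne : bandOver S (ξ S) j ≠ T' := fun h => hC (h ▸ hT')
      exact h𝒯part.pairwiseDisjoint hT (h𝒞τ hT') hne
  · -- (5): the bands over `S` among the cells of `σ`
    refine ⟨Finset.univ.filter fun j => bandOver S (ξ S) j ∈ 𝒞σ, fun j hj => ?_, fun x hx t ht => ?_⟩
    · rw [Finset.mem_filter] at hj
      rw [← hσU]
      exact subset_sUnion_of_mem hj.2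
    · rw [← hσU] at ht
      obtain ⟨T, hT𝒞, hzT⟩ := mem_sUnion.1 ht
      obtain ⟨S', hS', hT⟩ := (hmem T).1 (h𝒞σ hT𝒞)
      have hxS' : x ∈ S' := by
        rcases hT with ⟨j, rfl⟩ | ⟨j, rfl⟩
        · exact (snoc_mem_graphOver_iff.1 hzT).1
        · exact (snoc_mem_bandOver_iff.1 hzT).1
      obtain rfl : S' = S := by
        obtain ⟨U, -, huniq⟩ := h𝒮part.2 x
        exact (huniq S' ⟨hS', hxS'⟩).trans (huniq S ⟨hS, hx⟩).symm
      rcases hT with ⟨j, rfl⟩ | ⟨j, rfl⟩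
      · exact Or.inl ⟨j, (snoc_mem_graphOver_iff.1 hzT).2⟩
      · exact Or.inr ⟨j, Finset.mem_filter.2 ⟨Finset.mem_univ _, hT𝒞⟩,
          (snoc_mem_bandOver_iff.1 hzT).2⟩

end Summit.KontsevichZagierPeriods.FermatIsogeny.BetaLinearSector
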